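import Summits.KontsevichZagierPeriods.KontsevichZagierPeriods.Theses.FurushoPentagon
import Literature.NumberTheory.Transcendental.KZCalculusProofs
import Literature.NumberTheory.Transcendental.SemialgebraicMapsProofs
import Literature.NumberTheory.Transcendental.MultipleZeta

/-!
# drefute — `stub_dilationCalculus` of line `dilation-homotopy-transposition` (crux stmt-KontsevichZagierPeriods-3930)

The dilation calculus of the cubical integrand `f_s`: Euler homogeneity
`∂_λ[λ f_s(σ_λ x)] = K_s(σ_λ x)`, continuity on `[0,1]`, `K_s ≥ 0`, and semialgebraicity of the peak
kernel and of its primitive on the big band.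
-/

noncomputable section
set_option linter.dupNamespace false
open Set MeasureTheory MvPolynomial
open Literature.NumberTheory.Transcendental
open Literature.ModelTheory.ExponentialFields (IsSemialgebraic)

namespace Summit.KontsevichZagierPeriods.KontsevichZagierPeriods.Cruxes.HoffmanRelationInKZ.DrefuteCalc

variable {n : ℕ}

/-- The block product `T_m(x) = ∏_{j<m} x_j` (exactly the sub-term of the stubs). -/
def Tm (m : ℕ) (x : Fin n → ℝ) : ℝ := ∏ j : Fin n, if (j : ℕ) < m then x j else 1

theorem Tm_zero (x : Fin n → ℝ) : Tm 0 x = 1 := by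
  simp [Tm]

theorem Tm_nonneg {m : ℕ} {x : Fin n → ℝ} (hx : ∀ j, 0 ≤ x j) : 0 ≤ Tm m x :=
  Finset.prod_nonneg fun j _ => by split_ifs <;> simp [hx j]

theorem Tm_pos {m : ℕ} {x : Fin n → ℝ} (hx : ∀ j, 0 < x j) : 0 < Tm m x :=
  Finset.prod_pos fun j _ => by split_ifs <;> simp [hx j]

theorem Tm_le_one {m : ℕ} {x : Fin n → ℝ} (hx : ∀ j, x j ∈ Icc (0:ℝ) 1) : Tm m x ≤ 1 :=
  Finset.prod_le_one (fun j _ => by split_ifs <;> simp [(hx j).1]) fun j _ => by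
    split_ifs <;> simp [(hx j).2]

/-- For `m ≥ 1` (and `n ≥ 1`) the block product is `< 1` on the open cube. -/
theorem Tm_lt_one {m : ℕ} (hm : 1 ≤ m) (hn : 0 < n) {x : Fin n → ℝ} (hx : ∀ j, x j ∈ Ioo (0:ℝ) 1) :
    Tm m x < 1 := by
  have h0 : (⟨0, hn⟩ : Fin n) ∈ (Finset.univ : Finset (Fin n)) := Finset.mem_univ _
  rw [Tm, ← Finset.mul_prod_erase _ _ h0]
  have h1 : (if ((⟨0, hn⟩ : Fin n) : ℕ) < m then x ⟨0, hn⟩ else 1) = x ⟨0, hn⟩ := by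
    simp [show (0:ℕ) < m from hm]
  rw [h1]
  have h2 : ∏ j ∈ Finset.univ.erase (⟨0, hn⟩ : Fin n), (if (j : ℕ) < m then x j else 1) ≤ 1 :=
    Finset.prod_le_one (fun j _ => by split_ifs <;> simp [(hx j).1.le]) fun j _ => by
      split_ifs <;> simp [(hx j).2.le]
  have h3 : 0 ≤ ∏ j ∈ Finset.univ.erase (⟨0, hn⟩ : Fin n), (if (j : ℕ) < m then x j else 1) :=
    Finset.prod_nonneg fun j _ => by split_ifs <;> simp [(hx j).1.le]
  calc x ⟨0, hn⟩ * _ ≤ x ⟨0, hn⟩ * 1 := mul_le_mul_of_nonneg_left h2 (hx _).1.le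
    _ < 1 := by simpa using (hx _).2

section Shear

variable (σ : ℝ → (Fin n → ℝ) → (Fin n → ℝ))
  (hσ : ∀ (c : ℝ) (x : Fin n → ℝ) (j : Fin n), σ c x j = if (j : ℕ) = 0 then c * x j else x j)
include hσ

/-- The shear scales every non-trivial block product: `T_m(σ_c x) = c · T_m(x)` for `m ≥ 1`. -/
theorem Tm_shear {m : ℕ} (hm : 1 ≤ m) (hn : 0 < n) (c : ℝ) (x : Fin n → ℝ) :
    Tm m (σ c x) = c * Tm m x := by
  have h0 : (⟨0, hn⟩ : Fin n) ∈ (Finset.univ : Finset (Fin n)) := Finset.mem_univ _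
  rw [Tm, Tm, ← Finset.mul_prod_erase _ _ h0, ← Finset.mul_prod_erase _ _ h0]
  have h1 : (if ((⟨0, hn⟩ : Fin n) : ℕ) < m then σ c x ⟨0, hn⟩ else 1) = c * x ⟨0, hn⟩ := by
    rw [if_pos (show ((⟨0, hn⟩ : Fin n) : ℕ) < m from hm), hσ]; simp
  have h2 : (if ((⟨0, hn⟩ : Fin n) : ℕ) < m then x ⟨0, hn⟩ else 1) = x ⟨0, hn⟩ :=
    if_pos (show ((⟨0, hn⟩ : Fin n) : ℕ) < m from hm)
  have h3 : ∏ j ∈ Finset.univ.erase (⟨0, hn⟩ : Fin n), (if (j : ℕ) < m then σ c x j else 1) =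
      ∏ j ∈ Finset.univ.erase (⟨0, hn⟩ : Fin n), (if (j : ℕ) < m then x j else 1) := by
    refine Finset.prod_congr rfl fun j hj => ?_
    have hj0 : (j : ℕ) ≠ 0 := by
      intro h; apply (Finset.mem_erase.mp hj).1; ext; exact h
    rw [hσ, if_neg hj0]
  rw [h1, h2, h3]; ring

theorem shear_nonneg {c : ℝ} (hc : 0 ≤ c) {x : Fin n → ℝ} (hx : ∀ j, 0 ≤ x j) (j : Fin n) :
    0 ≤ σ c x j := by
  rw [hσ]; split_ifs <;> nlinarith [hx j]

/-- Continuity of `c ↦ T_m(σ_c x)`. -/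
theorem continuous_Tm_shear (m : ℕ) (x : Fin n → ℝ) : Continuous fun c : ℝ => Tm m (σ c x) := by
  unfold Tm
  refine continuous_finsetProd _ fun j _ => ?_
  simp only [hσ]
  split_ifs <;> fun_prop

end Shear

/-! ### The cubical integrand and its dilation kernel for an index `s` -/

section Index

variable (s : List ℕ)

/-- Prefix sums `p_l = s₁ + ⋯ + s_l`. -/
def P (l : ℕ) : ℕ := (s.take l).sum

theorem P_zero : P s 0 = 0 := by simp [P]

theorem one_le_P_succ {s : List ℕ} (hs : MZV.IsAdmissible s) (hne : s ≠ []) (l : ℕ) :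
    1 ≤ P s (l + 1) := by
  obtain ⟨a, t, rfl⟩ := List.exists_cons_of_ne_nil hne
  have ha : 2 ≤ a := hs.2 (List.cons_ne_nil a t)
  simp only [P, List.take_succ_cons, List.sum_cons]
  omega

theorem one_le_P_of_pos {s : List ℕ} (hs : MZV.IsAdmissible s) (hne : s ≠ []) {l : ℕ} (hl : 0 < l) :
    1 ≤ P s l := by
  obtain ⟨l', rfl⟩ := Nat.exists_eq_succ_of_ne_zero hl.ne'
  exact one_le_P_succ hs hne l'

theorem weight_pos {s : List ℕ} (hs : MZV.IsAdmissible s) (hne : s ≠ []) : 0 < MZV.weight s := by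
  obtain ⟨a, t, rfl⟩ := List.exists_cons_of_ne_nil hne
  have ha : 2 ≤ a := hs.2 (List.cons_ne_nil a t)
  simp only [MZV.weight, List.sum_cons]
  omega

end Index


/-! ### Part 2: the data `(f, K, σ)` of an index `s`: positivity and continuity -/

section Data

variable {s : List ℕ} (hs : MZV.IsAdmissible s) (hne : s ≠ [])
  (f : (Fin (MZV.weight s) → ℝ) → ℝ) (K : (Fin (MZV.weight s) → ℝ) → ℝ)
  (σ : ℝ → (Fin (MZV.weight s) → ℝ) → (Fin (MZV.weight s) → ℝ))
  (hf : ∀ x, f x = ∏ l : Fin s.length, (∏ j : Fin (MZV.weight s), if (j : ℕ) < (s.take l).sum then x j else 1) / (1 - (∏ j : Fin (MZV.weight s), if (j : ℕ) < (s.take ((l : ℕ) + 1)).sum then x j else 1)))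
  (hK : ∀ x, K x = f x * ∑ l : Fin s.length, 1 / (1 - (∏ j : Fin (MZV.weight s), if (j : ℕ) < (s.take ((l : ℕ) + 1)).sum then x j else 1)))
  (hσ : ∀ (c : ℝ) (x : Fin (MZV.weight s) → ℝ) (j : Fin (MZV.weight s)), σ c x j = if (j : ℕ) = 0 then c * x j else x j)

include hf in
theorem f_eq (x : Fin (MZV.weight s) → ℝ) :
    f x = ∏ l : Fin s.length, Tm (P s l) x / (1 - Tm (P s ((l : ℕ) + 1)) x) := by
  rw [hf]; rfl

include hf hK in
theorem K_eq (x : Fin (MZV.weight s) → ℝ) :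
    K x = (∏ l : Fin s.length, Tm (P s l) x / (1 - Tm (P s ((l : ℕ) + 1)) x)) *
      ∑ l : Fin s.length, 1 / (1 - Tm (P s ((l : ℕ) + 1)) x) := by
  rw [hK, hf]; rfl

include hs hne hσ in
/-- On the closed dilation range the denominators stay positive. -/
theorem den_pos {x : Fin (MZV.weight s) → ℝ} (hx : ∀ j, x j ∈ Ioo (0:ℝ) 1) {c : ℝ} (hc : c ∈ Icc (0:ℝ) 1)
    (l : ℕ) : 0 < 1 - Tm (P s (l + 1)) (σ c x) := by
  have hn := weight_pos hs hne
  rw [Tm_shear σ hσ (one_le_P_succ hs hne l) hn]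
  have hT : Tm (P s (l + 1)) x < 1 := Tm_lt_one (one_le_P_succ hs hne l) hn hx
  have hT0 : 0 < Tm (P s (l + 1)) x := Tm_pos fun j => (hx j).1
  nlinarith [hc.1, hc.2]

include hσ in
theorem num_nonneg {x : Fin (MZV.weight s) → ℝ} (hx : ∀ j, x j ∈ Ioo (0:ℝ) 1) {c : ℝ} (hc : c ∈ Icc (0:ℝ) 1)
    (m : ℕ) : 0 ≤ Tm m (σ c x) :=
  Tm_nonneg (shear_nonneg σ hσ hc.1 (fun j => (hx j).1.le))

include hs hne hf hσ in
theorem f_shear_nonneg {x : Fin (MZV.weight s) → ℝ} (hx : ∀ j, x j ∈ Ioo (0:ℝ) 1) {c : ℝ}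
    (hc : c ∈ Icc (0:ℝ) 1) : 0 ≤ f (σ c x) := by
  rw [f_eq f hf]
  exact Finset.prod_nonneg fun l _ =>
    div_nonneg (num_nonneg σ hσ hx hc _) (den_pos hs hne σ hσ hx hc l).le

include hs hne hf hK hσ in
/-- **(iv)** `K_s(σ_λ x) ≥ 0` for `λ ∈ [0,1]`. -/
theorem K_shear_nonneg (x : Fin (MZV.weight s) → ℝ) (hx : ∀ j, x j ∈ Ioo (0:ℝ) 1) (c : ℝ)
    (hc : c ∈ Icc (0:ℝ) 1) : 0 ≤ K (σ c x) := by
  rw [K_eq f K hf hK, ← f_eq f hf]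
  refine mul_nonneg (f_shear_nonneg hs hne f σ hf hσ hx hc) (Finset.sum_nonneg fun l _ => ?_)
  exact div_nonneg zero_le_one (den_pos hs hne σ hσ hx hc l).le

include hs hne hf hσ in
/-- **(ii)** continuity of `λ ↦ λ f_s(σ_λ x)` on `[0,1]`. -/
theorem continuousOn_mul_f_shear (x : Fin (MZV.weight s) → ℝ) (hx : ∀ j, x j ∈ Ioo (0:ℝ) 1) :
    ContinuousOn (fun l : ℝ => l * f (σ l x)) (Icc 0 1) := by
  have hfun : (fun l : ℝ => l * f (σ l x)) =
      fun l => l * ∏ i : Fin s.length, Tm (P s i) (σ l x) / (1 - Tm (P s ((i : ℕ) + 1)) (σ l x)) := by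
    funext l; rw [f_eq f hf]
  rw [hfun]
  refine continuousOn_id.mul (continuousOn_finsetProd _ fun i _ => ?_)
  refine (continuous_Tm_shear σ hσ _ x).continuousOn.div
    (continuous_const.sub (continuous_Tm_shear σ hσ _ x)).continuousOn fun c hc => ?_
  exact (den_pos hs hne σ hσ hx hc i).ne'

include hs hne hf hK hσ in
/-- **(iii)** continuity of `λ ↦ K_s(σ_λ x)` on `[0,1]`. -/
theorem continuousOn_K_shear (x : Fin (MZV.weight s) → ℝ) (hx : ∀ j, x j ∈ Ioo (0:ℝ) 1) :
    ContinuousOn (fun l : ℝ => K (σ l x)) (Icc 0 1) := by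
  have hfun : (fun l : ℝ => K (σ l x)) =
      fun l => (∏ i : Fin s.length, Tm (P s i) (σ l x) / (1 - Tm (P s ((i : ℕ) + 1)) (σ l x))) *
        ∑ i : Fin s.length, 1 / (1 - Tm (P s ((i : ℕ) + 1)) (σ l x)) := by
    funext l; rw [K_eq f K hf hK]
  rw [hfun]
  refine (continuousOn_finsetProd _ fun i _ => ?_).mul (continuousOn_finsetSum _ fun i _ => ?_)
  · refine (continuous_Tm_shear σ hσ _ x).continuousOn.div
      (continuous_const.sub (continuous_Tm_shear σ hσ _ x)).continuousOn fun c hc => ?_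
    exact (den_pos hs hne σ hσ hx hc i).ne'
  · refine continuousOn_const.div
      (continuous_const.sub (continuous_Tm_shear σ hσ _ x)).continuousOn fun c hc => ?_
    exact (den_pos hs hne σ hσ hx hc i).ne'

end Data


/-! ### Part 3: semialgebraicity on the big band -/

section Semialgebraic

variable {m : ℕ}

/-- Finite products of semialgebraic functions are semialgebraic. -/
theorem isSemialgebraicFunOn_finset_prod {ι : Type*} [DecidableEq ι] (S : Finset ι)
    {t : Set (Fin m → ℝ)} (ht : IsSemialgebraic ℚ t) (g : ι → (Fin m → ℝ) → ℝ)
    (h : ∀ i ∈ S, IsSemialgebraicFunOn ℚ t (g i)) :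
    IsSemialgebraicFunOn ℚ t (fun z => ∏ i ∈ S, g i z) := by
  revert h
  refine Finset.induction_on S ?_ ?_
  · intro _
    exact (isSemialgebraicFunOn_natCast ht 1).congr fun z _ => by simp
  · intro a S ha ih h
    have := IsSemialgebraicFunOn.mul_holds (h a (Finset.mem_insert_self a S))
      (ih fun i hi => h i (Finset.mem_insert_of_mem hi))
    exact this.congr fun z _ => by simp [Finset.prod_insert ha]

/-- Finite sums of semialgebraic functions are semialgebraic. -/
theorem isSemialgebraicFunOn_finset_sum {ι : Type*} [DecidableEq ι] (S : Finset ι)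
    {t : Set (Fin m → ℝ)} (ht : IsSemialgebraic ℚ t) (g : ι → (Fin m → ℝ) → ℝ)
    (h : ∀ i ∈ S, IsSemialgebraicFunOn ℚ t (g i)) :
    IsSemialgebraicFunOn ℚ t (fun z => ∑ i ∈ S, g i z) := by
  revert h
  refine Finset.induction_on S ?_ ?_
  · intro _
    exact (isSemialgebraicFunOn_natCast ht 0).congr fun z _ => by simp
  · intro a S ha ih h
    have := IsSemialgebraicFunOn.add_holds (h a (Finset.mem_insert_self a S))
      (ih fun i hi => h i (Finset.mem_insert_of_mem hi))
    exact this.congr fun z _ => by simp [Finset.sum_insert ha]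

/-- The big band `{(u,x) ∈ (0,1)ᵐ⁺¹, 0 ≤ λ ≤ 1}`. -/
def bigBand (m : ℕ) : Set (Fin (m + 2) → ℝ) :=
  {z | (∀ i, Fin.init z i ∈ Ioo (0:ℝ) 1) ∧ 0 ≤ z (Fin.last (m + 1)) ∧ z (Fin.last (m + 1)) ≤ 1}

theorem isSemialgebraic_bigBand : IsSemialgebraic ℚ (bigBand m) := by
  have h1 : IsSemialgebraic ℚ {z : Fin (m + 2) → ℝ | ∀ i : Fin (m + 1), 0 < Fin.init z i} := by
    have : {z : Fin (m + 2) → ℝ | ∀ i : Fin (m + 1), 0 < Fin.init z i} = ⋂ i ∈ (Finset.univ : Finset (Fin (m + 1))),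
        {z | 0 < aeval z (X i.castSucc : MvPolynomial (Fin (m + 2)) ℚ)} := by
      ext z; simp [Fin.init]
    rw [this]
    exact IsSemialgebraic.biInter _ _ fun i _ =>
      Literature.ModelTheory.ExponentialFields.isSemialgebraic_setOf_eval_pos (k := ℚ) _
  have h2 : IsSemialgebraic ℚ {z : Fin (m + 2) → ℝ | ∀ i : Fin (m + 1), Fin.init z i < 1} := by
    have : {z : Fin (m + 2) → ℝ | ∀ i : Fin (m + 1), Fin.init z i < 1} = ⋂ i ∈ (Finset.univ : Finset (Fin (m + 1))),
        {z | 0 < aeval z (1 - X i.castSucc : MvPolynomial (Fin (m + 2)) ℚ)} := by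
      ext z; simp [Fin.init, sub_pos]
    rw [this]
    exact IsSemialgebraic.biInter _ _ fun i _ =>
      Literature.ModelTheory.ExponentialFields.isSemialgebraic_setOf_eval_pos (k := ℚ) _
  have h3 := Literature.ModelTheory.ExponentialFields.isSemialgebraic_setOf_eval_le (k := ℚ) (R := ℝ)
    (0 : MvPolynomial (Fin (m + 2)) ℚ) (X (Fin.last (m + 1)))
  have h4 := Literature.ModelTheory.ExponentialFields.isSemialgebraic_setOf_eval_le (k := ℚ) (R := ℝ)
    (X (Fin.last (m + 1)) : MvPolynomial (Fin (m + 2)) ℚ) 1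
  convert ((h1.inter h2).inter h3).inter h4 using 1
  ext z
  simp only [bigBand, mem_Ioo, mem_setOf_eq, mem_inter_iff, forall_and, map_zero, aeval_X, map_one, and_assoc]

variable {s : List ℕ} (hs : MZV.IsAdmissible s) (hne : s ≠ [])
  (f : (Fin (MZV.weight s) → ℝ) → ℝ) (K : (Fin (MZV.weight s) → ℝ) → ℝ)
  (σ : ℝ → (Fin (MZV.weight s) → ℝ) → (Fin (MZV.weight s) → ℝ))
  (hf : ∀ x, f x = ∏ l : Fin s.length, (∏ j : Fin (MZV.weight s), if (j : ℕ) < (s.take l).sum then x j else 1) / (1 - (∏ j : Fin (MZV.weight s), if (j : ℕ) < (s.take ((l : ℕ) + 1)).sum then x j else 1)))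
  (hK : ∀ x, K x = f x * ∑ l : Fin s.length, 1 / (1 - (∏ j : Fin (MZV.weight s), if (j : ℕ) < (s.take ((l : ℕ) + 1)).sum then x j else 1)))
  (hσ : ∀ (c : ℝ) (x : Fin (MZV.weight s) → ℝ) (j : Fin (MZV.weight s)), σ c x j = if (j : ℕ) = 0 then c * x j else x j)

/-- The coordinates of the dilated point `σ_λ x` as polynomials in `z = (u, x, λ)`. -/
def wPoly (s : List ℕ) (j : Fin (MZV.weight s)) : MvPolynomial (Fin (MZV.weight s + 2)) ℚ :=
  if (j : ℕ) = 0 then X (Fin.last (MZV.weight s + 1)) * X j.succ.castSucc else X j.succ.castSucc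

include hσ in
theorem aeval_wPoly (z : Fin (MZV.weight s + 2) → ℝ) (j : Fin (MZV.weight s)) :
    aeval z (wPoly s j) = σ (z (Fin.last (MZV.weight s + 1))) (Fin.tail (Fin.init z)) j := by
  rw [hσ, wPoly]
  split_ifs <;> simp [Fin.tail, Fin.init]

/-- The block products of the dilated point as polynomials. -/
def TmPoly (s : List ℕ) (m : ℕ) : MvPolynomial (Fin (MZV.weight s + 2)) ℚ :=
  ∏ j : Fin (MZV.weight s), if (j : ℕ) < m then wPoly s j else 1

include hσ in
theorem aeval_TmPoly (z : Fin (MZV.weight s + 2) → ℝ) (m : ℕ) :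
    aeval z (TmPoly s m) = Tm m (σ (z (Fin.last (MZV.weight s + 1))) (Fin.tail (Fin.init z))) := by
  unfold TmPoly Tm
  rw [map_prod]
  refine Finset.prod_congr rfl fun j _ => ?_
  split_ifs
  · exact aeval_wPoly σ hσ z j
  · simp

/-- Points of the big band dilate into the closed range: base point in the open cube, `λ ∈ [0,1]`. -/
theorem bigBand_coords {z : Fin (MZV.weight s + 2) → ℝ} (hz : z ∈ bigBand (MZV.weight s)) :
    (∀ j, Fin.tail (Fin.init z) j ∈ Ioo (0:ℝ) 1) ∧ z (Fin.last (MZV.weight s + 1)) ∈ Icc (0:ℝ) 1 ∧ z 0 < 1 := by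
  refine ⟨fun j => hz.1 j.succ, ⟨hz.2.1, hz.2.2⟩, ?_⟩
  have := (hz.1 0).2
  simpa [Fin.init] using this

include hs hne hσ in
theorem den_ne_zero_bigBand {z : Fin (MZV.weight s + 2) → ℝ} (hz : z ∈ bigBand (MZV.weight s)) (l : ℕ) :
    aeval z (1 - TmPoly s (P s (l + 1))) ≠ 0 := by
  obtain ⟨hx, hc, -⟩ := bigBand_coords hz
  rw [map_sub, map_one, aeval_TmPoly σ hσ]
  exact (den_pos hs hne σ hσ hx hc l).ne'

include hs hne hf hσ in
/-- `z ↦ f_s(σ_λ x)` is semialgebraic on the big band. -/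
theorem isSemialgebraicFunOn_f_dil :
    IsSemialgebraicFunOn ℚ (bigBand (MZV.weight s))
      (fun z => f (σ (z (Fin.last (MZV.weight s + 1))) (Fin.tail (Fin.init z)))) := by
  have h := isSemialgebraicFunOn_finset_prod (Finset.univ : Finset (Fin s.length)) isSemialgebraic_bigBand
    (fun l z => aeval z (TmPoly s (P s l)) / aeval z (1 - TmPoly s (P s ((l : ℕ) + 1))))
    fun l _ => isSemialgebraicFunOn_aeval_div_aeval isSemialgebraic_bigBand _ _
      fun z hz => den_ne_zero_bigBand hs hne σ hσ hz l
  refine h.congr fun z _ => ?_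
  simp only [f_eq f hf, map_sub, map_one, aeval_TmPoly σ hσ]

include hs hne hf hK hσ in
/-- `z ↦ K_s(σ_λ x)` is semialgebraic on the big band. -/
theorem isSemialgebraicFunOn_K_dil :
    IsSemialgebraicFunOn ℚ (bigBand (MZV.weight s))
      (fun z => K (σ (z (Fin.last (MZV.weight s + 1))) (Fin.tail (Fin.init z)))) := by
  have h1 := isSemialgebraicFunOn_f_dil hs hne f σ hf hσ
  have h2 := isSemialgebraicFunOn_finset_sum (Finset.univ : Finset (Fin s.length)) isSemialgebraic_bigBand
    (fun l z => aeval z (1 : MvPolynomial (Fin (MZV.weight s + 2)) ℚ) / aeval z (1 - TmPoly s (P s ((l : ℕ) + 1))))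
    fun l _ => isSemialgebraicFunOn_aeval_div_aeval isSemialgebraic_bigBand _ _
      fun z hz => den_ne_zero_bigBand hs hne σ hσ hz l
  refine (IsSemialgebraicFunOn.mul_holds h1 h2).congr fun z _ => ?_
  simp only [Pi.mul_apply, K_eq f K hf hK, ← f_eq f hf, map_sub, map_one, aeval_TmPoly σ hσ]

include hs hne hf hK hσ in
/-- **(v)** the peak integrand is semialgebraic on the big band. -/
theorem isSemialgebraicFunOn_peak :
    IsSemialgebraicFunOn ℚ {z : Fin (MZV.weight s + 2) → ℝ | (∀ i, Fin.init z i ∈ Set.Ioo (0:ℝ) 1) ∧ 0 ≤ z (Fin.last (MZV.weight s + 1)) ∧ z (Fin.last (MZV.weight s + 1)) ≤ 1}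
      (fun z => K (σ (z (Fin.last (MZV.weight s + 1))) (Fin.tail (Fin.init z))) / (1 - z 0)) := by
  have h1 := isSemialgebraicFunOn_K_dil hs hne f K σ hf hK hσ
  have h2 : IsSemialgebraicFunOn ℚ (bigBand (MZV.weight s))
      (fun z => aeval z (1 : MvPolynomial (Fin (MZV.weight s + 2)) ℚ) / aeval z (1 - X 0 : MvPolynomial (Fin (MZV.weight s + 2)) ℚ)) :=
    isSemialgebraicFunOn_aeval_div_aeval isSemialgebraic_bigBand _ _ fun z hz => by
      have := (bigBand_coords (s := s) hz).2.2
      simp only [map_sub, map_one, aeval_X]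
      exact (sub_pos.mpr this).ne'
  refine (IsSemialgebraicFunOn.mul_holds h1 h2).congr fun z _ => ?_
  simp only [Pi.mul_apply, map_sub, map_one, aeval_X]
  ring

include hs hne hf hσ in
/-- **(vi)** the primitive `λ f_s(σ_λ x)/(1−u)` is semialgebraic on the big band. -/
theorem isSemialgebraicFunOn_prim :
    IsSemialgebraicFunOn ℚ {z : Fin (MZV.weight s + 2) → ℝ | (∀ i, Fin.init z i ∈ Set.Ioo (0:ℝ) 1) ∧ 0 ≤ z (Fin.last (MZV.weight s + 1)) ∧ z (Fin.last (MZV.weight s + 1)) ≤ 1}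
      (fun z => z (Fin.last (MZV.weight s + 1)) * f (σ (z (Fin.last (MZV.weight s + 1))) (Fin.tail (Fin.init z))) / (1 - z 0)) := by
  have h1 := isSemialgebraicFunOn_f_dil hs hne f σ hf hσ
  have h2 : IsSemialgebraicFunOn ℚ (bigBand (MZV.weight s))
      (fun z => aeval z (X (Fin.last (MZV.weight s + 1)) : MvPolynomial (Fin (MZV.weight s + 2)) ℚ) / aeval z (1 - X 0 : MvPolynomial (Fin (MZV.weight s + 2)) ℚ)) :=
    isSemialgebraicFunOn_aeval_div_aeval isSemialgebraic_bigBand _ _ fun z hz => by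
      have := (bigBand_coords (s := s) hz).2.2
      simp only [map_sub, map_one, aeval_X]
      exact (sub_pos.mpr this).ne'
  refine (IsSemialgebraicFunOn.mul_holds h1 h2).congr fun z _ => ?_
  simp only [Pi.mul_apply, map_sub, map_one, aeval_X]
  ring

end Semialgebraic


/-! ### Part 4: Euler homogeneity `∂_λ[λ f_s(σ_λ x)] = K_s(σ_λ x)` -/

section Derivative

/-- The algebra of the derivative: logarithmic-derivative bookkeeping. -/
theorem deriv_identity {ι : Type*} [Fintype ι] [DecidableEq ι] (i₀ : ι) (l : ℝ) (hl : l ≠ 0)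
    (a b D N N' φ φ' : ι → ℝ) (hD : ∀ i, D i ≠ 0) (hDeq : ∀ i, D i = 1 - l * a i)
    (hb : ∀ i, i ≠ i₀ → b i ≠ 0)
    (hN : ∀ i, N i = if i = i₀ then 1 else l * b i) (hN' : ∀ i, N' i = if i = i₀ then 0 else b i)
    (hφ : ∀ i, φ i = N i / D i) (hφ' : ∀ i, φ' i = (N' i * D i - N i * (-a i)) / D i ^ 2) :
    1 * (∏ i, φ i) + l * ∑ i, (∏ j ∈ Finset.univ.erase i, φ j) • φ' i = (∏ i, φ i) * ∑ i, 1 / D i := by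
  set F := ∏ i, φ i with hF
  have hφne : ∀ i, φ i ≠ 0 := by
    intro i
    rw [hφ, hN]
    split_ifs with hi
    · exact div_ne_zero one_ne_zero (hD i)
    · exact div_ne_zero (mul_ne_zero hl (hb i hi)) (hD i)
  have herase : ∀ i, ∏ j ∈ Finset.univ.erase i, φ j = F / φ i := fun i => by
    rw [eq_div_iff (hφne i), Finset.prod_erase_mul _ _ (Finset.mem_univ i)]
  have hterm : ∀ i, l * ((∏ j ∈ Finset.univ.erase i, φ j) • φ' i) = F / D i - (if i = i₀ then F else 0) := by
    intro i
    rw [herase, smul_eq_mul, hφ', hφ, hN, hN']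
    have hDi := hD i
    have hai : l * a i = 1 - D i := by linarith [hDeq i]
    by_cases hi : i = i₀
    · rw [if_pos hi, if_pos hi, if_pos hi]
      field_simp
      linear_combination (F) * hai
    · rw [if_neg hi, if_neg hi, if_neg hi]
      have hbi := hb i hi
      field_simp
      linear_combination (F) * hai
  rw [Finset.mul_sum, Finset.sum_congr rfl fun i _ => hterm i, Finset.sum_sub_distrib,
    Finset.sum_ite_eq' Finset.univ i₀ (fun _ => F), if_pos (Finset.mem_univ _), Finset.mul_sum]
  have : ∑ i, F / D i = ∑ i, F * (1 / D i) := Finset.sum_congr rfl fun i _ => by ring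
  rw [this]; ring

variable {s : List ℕ} (hs : MZV.IsAdmissible s) (hne : s ≠ [])
  (f : (Fin (MZV.weight s) → ℝ) → ℝ) (K : (Fin (MZV.weight s) → ℝ) → ℝ)
  (σ : ℝ → (Fin (MZV.weight s) → ℝ) → (Fin (MZV.weight s) → ℝ))
  (hf : ∀ x, f x = ∏ l : Fin s.length, (∏ j : Fin (MZV.weight s), if (j : ℕ) < (s.take l).sum then x j else 1) / (1 - (∏ j : Fin (MZV.weight s), if (j : ℕ) < (s.take ((l : ℕ) + 1)).sum then x j else 1)))
  (hK : ∀ x, K x = f x * ∑ l : Fin s.length, 1 / (1 - (∏ j : Fin (MZV.weight s), if (j : ℕ) < (s.take ((l : ℕ) + 1)).sum then x j else 1)))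
  (hσ : ∀ (c : ℝ) (x : Fin (MZV.weight s) → ℝ) (j : Fin (MZV.weight s)), σ c x j = if (j : ℕ) = 0 then c * x j else x j)

include hs hne hf hK hσ in
/-- **(i)** Euler homogeneity: `∂_λ[λ f_s(σ_λ x)] = K_s(σ_λ x)` for `λ ∈ (0,1)`, `x` in the open cube. -/
theorem hasDerivAt_mul_f_shear (x : Fin (MZV.weight s) → ℝ) (hx : ∀ j, x j ∈ Ioo (0:ℝ) 1)
    (l : ℝ) (hl : l ∈ Ioo (0:ℝ) 1) :
    HasDerivAt (fun c : ℝ => c * f (σ c x)) (K (σ l x)) l := by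
  have hn := weight_pos hs hne
  have hk : 0 < s.length := List.length_pos_of_ne_nil hne
  have hlc : l ∈ Icc (0:ℝ) 1 := ⟨hl.1.le, hl.2.le⟩
  set i₀ : Fin s.length := ⟨0, hk⟩ with hi₀
  have hival : ∀ i : Fin s.length, i = i₀ ↔ (i : ℕ) = 0 := fun i => by
    rw [Fin.ext_iff]
  -- the data of `deriv_identity`
  let a : Fin s.length → ℝ := fun i => Tm (P s ((i : ℕ) + 1)) x
  let b : Fin s.length → ℝ := fun i => Tm (P s i) x
  let D : Fin s.length → ℝ := fun i => 1 - Tm (P s ((i : ℕ) + 1)) (σ l x)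
  let N : Fin s.length → ℝ := fun i => Tm (P s i) (σ l x)
  let N' : Fin s.length → ℝ := fun i => if i = i₀ then 0 else b i
  let φ : Fin s.length → ℝ := fun i => N i / D i
  let φ' : Fin s.length → ℝ := fun i => (N' i * D i - N i * (-a i)) / D i ^ 2
  have hP0 : ∀ i : Fin s.length, i = i₀ → P s i = 0 := fun i hi => by
    rw [(hival i).mp hi]; exact P_zero s
  have hP1 : ∀ i : Fin s.length, i ≠ i₀ → 1 ≤ P s i := fun i hi =>
    one_le_P_of_pos hs hne (Nat.pos_of_ne_zero fun h => hi ((hival i).mpr h))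
  have hDpos : ∀ i, 0 < D i := fun i => den_pos hs hne σ hσ hx hlc i
  have hDeq : ∀ i, D i = 1 - l * a i := fun i => by
    show 1 - Tm (P s ((i : ℕ) + 1)) (σ l x) = 1 - l * Tm (P s ((i : ℕ) + 1)) x
    rw [Tm_shear σ hσ (one_le_P_succ hs hne i) hn]
  have hNeq : ∀ i, N i = if i = i₀ then 1 else l * b i := fun i => by
    show Tm (P s i) (σ l x) = if i = i₀ then 1 else l * Tm (P s i) x
    split_ifs with hi
    · rw [hP0 i hi, Tm_zero]
    · rw [Tm_shear σ hσ (hP1 i hi) hn]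
  have hb : ∀ i, i ≠ i₀ → b i ≠ 0 := fun i _ => (Tm_pos fun j => (hx j).1).ne'
  -- derivative of each factor
  have hnum : ∀ i : Fin s.length, HasDerivAt (fun c : ℝ => Tm (P s i) (σ c x)) (N' i) l := by
    intro i
    by_cases hi : i = i₀
    · have hfun : (fun c : ℝ => Tm (P s i) (σ c x)) = fun _ => 1 := funext fun c => by
        rw [hP0 i hi, Tm_zero]
      rw [hfun, show N' i = 0 from if_pos hi]
      exact hasDerivAt_const l 1
    · have hfun : (fun c : ℝ => Tm (P s i) (σ c x)) = fun c => c * b i := funext fun c => by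
        rw [Tm_shear σ hσ (hP1 i hi) hn]
      rw [hfun, show N' i = b i from if_neg hi]
      exact hasDerivAt_mul_const (b i)
  have hden : ∀ i : Fin s.length, HasDerivAt (fun c : ℝ => 1 - Tm (P s ((i : ℕ) + 1)) (σ c x)) (-a i) l := by
    intro i
    have hfun : (fun c : ℝ => 1 - Tm (P s ((i : ℕ) + 1)) (σ c x)) = fun c => 1 - c * a i :=
      funext fun c => by rw [Tm_shear σ hσ (one_le_P_succ hs hne i) hn]
    rw [hfun]
    exact (hasDerivAt_mul_const (a i)).const_sub 1
  have hfac : ∀ i : Fin s.length, HasDerivAt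
      (fun c : ℝ => Tm (P s i) (σ c x) / (1 - Tm (P s ((i : ℕ) + 1)) (σ c x))) (φ' i) l :=
    fun i => (hnum i).div (hden i) (hDpos i).ne'
  have hprod := HasDerivAt.finsetProd (u := Finset.univ) fun i _ => hfac i
  have hg := (hasDerivAt_id' l).mul hprod
  have hg' : HasDerivAt
      (fun c : ℝ => c * ∏ i : Fin s.length, Tm (P s i) (σ c x) / (1 - Tm (P s ((i : ℕ) + 1)) (σ c x))) _ l :=
    hg.congr_of_eventuallyEq (Filter.Eventually.of_forall fun c => by
      simp only [Pi.mul_apply, Finset.prod_apply])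
  have hfun : (fun c : ℝ => c * f (σ c x)) =
      fun c => c * ∏ i : Fin s.length, Tm (P s i) (σ c x) / (1 - Tm (P s ((i : ℕ) + 1)) (σ c x)) := by
    funext c; rw [f_eq f hf]
  rw [hfun]
  refine hg'.congr_deriv ?_
  have hid := deriv_identity i₀ l hl.1.ne' a b D N N' φ φ' (fun i => (hDpos i).ne') hDeq hb hNeq
    (fun _ => rfl) (fun _ => rfl) (fun _ => rfl)
  simp only [Finset.prod_apply]
  rw [K_eq f K hf hK]
  exact hid

end Derivative

/-! ### Assembly: the lead's `stub_dilationCalculus`, verbatim -/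

/-- **`stub_dilationCalculus` of the lead's skeleton, PROVED** (type copied verbatim). -/
theorem stub_dilationCalculus_proof : ∀ (s : List ℕ), MZV.IsAdmissible s → s ≠ [] → ∀ (f : (Fin (MZV.weight s) → ℝ) → ℝ) (K : (Fin (MZV.weight s) → ℝ) → ℝ) (σ : ℝ → (Fin (MZV.weight s) → ℝ) → (Fin (MZV.weight s) → ℝ)), (∀ x, f x = ∏ l : Fin s.length, (∏ j : Fin (MZV.weight s), if (j : ℕ) < (s.take l).sum then x j else 1) / (1 - (∏ j : Fin (MZV.weight s), if (j : ℕ) < (s.take ((l : ℕ) + 1)).sum then x j else 1))) → (∀ x, K x = f x * ∑ l : Fin s.length, 1 / (1 - (∏ j : Fin (MZV.weight s), if (j : ℕ) < (s.take ((l : ℕ) + 1)).sum then x j else 1))) → (∀ (c : ℝ) (x : Fin (MZV.weight s) → ℝ) (j : Fin (MZV.weight s)), σ c x j = if (j : ℕ) = 0 then c * x j else x j) → ((∀ x : Fin (MZV.weight s) → ℝ, (∀ i, x i ∈ Set.Ioo (0:ℝ) 1) → ∀ l ∈ Set.Ioo (0:ℝ) 1, HasDerivAt (fun l : ℝ =>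 l * f (σ l x)) (K (σ l x)) l) ∧ (∀ x : Fin (MZV.weight s) → ℝ, (∀ i, x i ∈ Set.Ioo (0:ℝ) 1) → ContinuousOn (fun l : ℝ => l * f (σ l x)) (Set.Icc 0 1)) ∧ (∀ x : Fin (MZV.weight s) → ℝ, (∀ i, x i ∈ Set.Ioo (0:ℝ) 1) → ContinuousOn (fun l : ℝ => K (σ l x)) (Set.Icc 0 1)) ∧ (∀ x : Fin (MZV.weight s) → ℝ, (∀ i, x i ∈ Set.Ioo (0:ℝ) 1) → ∀ l ∈ Set.Icc (0:ℝ) 1, 0 ≤ K (σ l x)) ∧ IsSemialgebraicFunOn ℚ {z : Fin (MZV.weight s + 2) → ℝ | (∀ i, Fin.init z i ∈ Set.Ioo (0:ℝ) 1) ∧ 0 ≤ z (Fin.last (MZV.weight s + 1)) ∧ z (Fin.last (MZV.weight s + 1)) ≤ 1} (fun z => K (σ (z (Fin.last (MZV.weight s + 1))) (Fin.tail (Fin.init z))) / (1 - z 0)) ∧ IsSemialgebraicFunOn ℚ {z : Fin (MZV.weight s + 2) → ℝ | (∀ i, Fin.init z i ∈ Set.Ioo (0:ℝ) 1) ∧ 0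 ≤ z (Fin.last (MZV.weight s + 1)) ∧ z (Fin.last (MZV.weight s + 1)) ≤ 1} (fun z => z (Fin.last (MZV.weight s + 1)) * f (σ (z (Fin.last (MZV.weight s + 1))) (Fin.tail (Fin.init z))) / (1 - z 0))) := by
  intro s hs hne f K σ hf hK hσ
  exact ⟨fun x hx l hl => hasDerivAt_mul_f_shear hs hne f K σ hf hK hσ x hx l hl,
    fun x hx => continuousOn_mul_f_shear hs hne f σ hf hσ x hx,
    fun x hx => continuousOn_K_shear hs hne f K σ hf hK hσ x hx,
    fun x hx l hl => K_shear_nonneg hs hne f K σ hf hK hσ x hx l hl,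
    isSemialgebraicFunOn_peak hs hne f K σ hf hK hσ,
    isSemialgebraicFunOn_prim hs hne f σ hf hσ⟩

end Summit.KontsevichZagierPeriods.KontsevichZagierPeriods.Cruxes.HoffmanRelationInKZ.DrefuteCalc
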